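import Literature.Geometry.Riemannian.PParabolicNhdSubsetConventional
import HarnessLib

/-!
# `P*`-parabolic neighbourhoods lie in conventional parabolic neighbourhoods under a local
# two-sided Ricci bound (Bamler 2020a, Cor. 9.6 (b); arXiv v1 Cor. 34 (b)), general `T⁻ ≥ 0`

R. Bamler, *Entropy and heat kernel bounds on a Ricci flow background*, arXiv:2008.07093 (2020a),
§9.1, Cor. 9.6 (b): if `|Ric| ≤ K r⁻²` on `P(x₀, t₀; A′ r, −T⁻ r², T⁺ r²)` and
`A′ ≥ A̲′(K, A, T⁻, T⁺)`, then `P*(x₀, t₀; A r, −T⁻ r², T⁺ r²) ⊂ P(x₀, t₀; A′ r, −T⁻ r², T⁺ r²)`. The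
source (§9.2, p. 27) reduces the general case to `T⁻ = 0`: *"by Proposition 9.5 for any
`(x, t) ∈ P*(x₀, t₀; A, −T⁻, T⁺)` we have `d^{g_{t₀−T⁻}}_{W₁}(ν_{x₀,t₀−T⁻;t₀−T⁻}, ν_{x,t;t₀−T⁻}) ≤
d_{W₁}(δ_{x₀}, ν_{x₀,t₀;t₀−T⁻}) + d_{W₁}(ν_{x₀,t₀;t₀−T⁻}, ν_{x,t;t₀−T⁻}) ≤ C(α, K, T⁻) + A`. Therefore
`P*(x₀, t₀; A, −T⁻, T⁺) ⊂ P*(x₀, t₀ − T⁻; C + A, 0, T⁻ + T⁺)`. By standard distance-distortion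
estimates we also have `P(x₀, t₀; A′, −T⁻, T⁺) ⊃ P(x₀, t₀ − T⁻; c(K, T⁻) A′, 0, T⁻ + T⁺)`."*

This file carries out exactly this reduction to the landed forward case
(`exists_edist_lt_of_mem_pParabolicNhd_of_ricci_bound`, `PParabolicNhdSubsetConventional.lean`)
for the metric flow `𝒳 = ricciFlowMetricFlow hh hR _ hflow` of a Ricci flow on a closed manifold:
`exists_edist_lt_of_mem_pParabolicNhd_of_ricci_bound_general`. With the base time `b = t₀ − T⁻ r²`:
the first summand is Prop. 9.5 in `W₁`-form at `(x₀, t₀)` over `[b, t₀]`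
(`wassersteinW1_condKernel_dirac_le_of_ricci_bound`, its curvature hypothesis from the bound on
`B_{t₀}(x₀, A′ r)` by `ricci_bound_parabolic_of_ricci_bound_ball`); so `(x, t)` lies in the FORWARD
neighbourhood `P*((x₀, b); (C + A) r, 0, (T⁻ + T⁺) r²)`; the forward case localises `x` in the
`g_b`-ball `B_b(x₀, A′₀ r)`; and the local backward distance distortion
(`edist_le_exp_mul_edist_of_ricci_bound_ball_rev`, `d_{t₀} ≤ e^{K(T⁻+T⁺)} d_b` inside the ball
carrying the curvature bound) converts both the hypothesis ball of the forward case and its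
conclusion to `g_{t₀}`-balls, for `A′ = e^{K(T⁻+T⁺)} (A′₀ + √(T⁻ + T⁺)) + 1`.

Everything is proved; no definitions, no named facts.

## References

* R. H. Bamler, *Entropy and heat kernel bounds on a Ricci flow background*, arXiv:2008.07093
  (2020), §9.1, Prop. 9.5, Cor. 9.6 (b) (arXiv v1: Prop. 33, Cor. 34 (b)); §9.2, proof of
  Cor. 9.6, p. 27. [Bamler2020Entropy]
* R. H. Bamler, *Compactness theory of the space of super Ricci flows*, Invent. Math. 233 (2023),
  §3.5 (`P*`-parabolic neighbourhoods). [Bamler2023]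
-/

noncomputable section

open Set Filter Function MeasureTheory Measure
open scoped Manifold ContDiff Topology ENNReal NNReal

namespace Literature.Geometry.Riemannian

open Lorentzian Lorentzian.PseudoRiemannianMetric MetricFlow

/-- **Bamler 2020a, Cor. 9.6 (b) (arXiv v1 Cor. 34 (b)): `P* ⊂ P` under a local two-sided Ricci
bound, general `T⁻ ≥ 0`.** For `m ≥ 3`, `K, A, T⁻, T⁺ ≥ 0` with `T⁻ + T⁺ > 0` there is
`A′ = A′(m, K, A, T⁻, T⁺) > 0` such that: for every Ricci flow `hflow = (h, cov)` on `[a, T]` of a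
smooth family of Riemannian metrics on a closed connected `m`-manifold, metric flow
`𝒳 = ricciFlowMetricFlow hh hR _ hflow`, all `x₀`, `t₀ ∈ [a, T]`, `r > 0` with
`a < b := t₀ − T⁻ r²` and `t₀ + T⁺ r² ≤ T`, if `|Ric_s(y)| ≤ (K/r²) g_s(y)` for all
`s ∈ [t₀ − T⁻ r², t₀ + T⁺ r²]` and `y ∈ B_{t₀}(x₀, A′ r)`, then every point `(x, t)`, `t ∈ [a, T]`,
of `𝒳.pParabolicNhd (x₀, t₀) (A r) (T⁻ r²) (T⁺ r²)` (i.e. `t ∈ [b, t₀ + T⁺ r²]`,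
`d^{b}_{W₁}(ν_{x₀,t₀;b}, ν_{x,t;b}) < A r`) satisfies `d_{t₀}(x₀, x) < A′ r`. Proof: the source's
reduction to the forward case (module docstring) — `d^{b}_{W₁}(δ_{x₀}, ν_{x,t;b}) <
((√H_m + C)√T⁻ + A) r` by Prop. 9.5 at `(x₀, t₀)`, the forward case
`exists_edist_lt_of_mem_pParabolicNhd_of_ricci_bound` at the base point `(x₀, b)`, and the backward
distance distortion `edist_le_exp_mul_edist_of_ricci_bound_ball_rev` between `g_b` and `g_{t₀}`.
[cite: Bamler2020Entropy, §9.1, Cor. 9.6 (b) (arXiv v1 Cor. 34 (b)); §9.2, proof, p. 27] -/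
theorem exists_edist_lt_of_mem_pParabolicNhd_of_ricci_bound_general (m : ℕ) (hm : 3 ≤ m)
    {K A Tm Tp : ℝ} (hK : 0 ≤ K) (hA : 0 ≤ A) (hTm : 0 ≤ Tm) (hTp : 0 ≤ Tp) (hT : 0 < Tm + Tp) :
    ∃ A' : ℝ, 0 < A' ∧ ∀ {M : Type*} [TopologicalSpace M]
      [ChartedSpace (EuclideanSpace ℝ (Fin m)) M]
      [IsManifold 𝓘(ℝ, EuclideanSpace ℝ (Fin m)) ∞ M] [T2Space M] [CompactSpace M]
      [SecondCountableTopology M] [MeasurableSpace M] [BorelSpace M] [ConnectedSpace M]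
      {h : ℝ → PseudoRiemannianMetric 𝓘(ℝ, EuclideanSpace ℝ (Fin m)) ∞ (EuclideanSpace ℝ (Fin m))
        (TangentSpace 𝓘(ℝ, EuclideanSpace ℝ (Fin m)) : M → Type _)}
      {cov : ℝ → CovariantDerivative 𝓘(ℝ, EuclideanSpace ℝ (Fin m)) (EuclideanSpace ℝ (Fin m))
        (TangentSpace 𝓘(ℝ, EuclideanSpace ℝ (Fin m)) : M → Type _)}
      {a T : ℝ} (hflow : IsRicciFlow h cov (Icc a T)) (hh : IsContMDiffFamilyOn ∞ h univ)
      (hR : ∀ r, (h r).IsRiemannian),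
      ∀ {t₀ r : ℝ} (ht₀ : t₀ ∈ Icc a T) (hb : t₀ - Tm * r ^ 2 ∈ Icc a T),
      a < t₀ - Tm * r ^ 2 → 0 < r → t₀ + Tp * r ^ 2 ≤ T → ∀ x₀ : M,
      (∀ s ∈ Icc (t₀ - Tm * r ^ 2) (t₀ + Tp * r ^ 2), ∀ y : M,
        (h t₀).edist (hR t₀) x₀ y < ENNReal.ofReal (A' * r) →
        ∀ v : TangentSpace 𝓘(ℝ, EuclideanSpace ℝ (Fin m)) y,
          |(cov s).ricci y v v| ≤ K / r ^ 2 * (h s).val y v v) →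
      ∀ {t : ℝ} (ht : t ∈ Icc a T) (x : M),
      (⟨⟨t, ht⟩, x⟩ : (ricciFlowMetricFlow hh hR Set.ordConnected_Icc hflow).Pt) ∈
        (ricciFlowMetricFlow hh hR Set.ordConnected_Icc hflow).pParabolicNhd ⟨⟨t₀, ht₀⟩, x₀⟩
          (A * r) (Tm * r ^ 2) (Tp * r ^ 2) hb →
      (h t₀).edist (hR t₀) x₀ x < ENNReal.ofReal (A' * r) := by
  classical
  -- the constants
  set Θ : ℝ := Tm + Tp with hΘ
  have hΘ0 : 0 ≤ Θ := hT.le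
  set L : ℝ := Real.exp (K * Θ) with hL
  have hL0 : 0 < L := Real.exp_pos _
  have hL1 : 1 ≤ L := Real.one_le_exp (mul_nonneg hK hΘ0)
  have hH0 : 0 ≤ MetricFlow.concentrationConst m := by
    have h3 : (3 : ℝ) ≤ m := by exact_mod_cast hm
    have h1 : 0 ≤ ((m : ℝ) - 1) * Real.pi ^ 2 / 2 :=
      div_nonneg (mul_nonneg (by linarith only [h3]) (sq_nonneg _)) zero_le_two
    rw [MetricFlow.concentrationConst]
    linarith only [h1]
  obtain ⟨C, hC, h95⟩ :=
    exists_edist_hCenter_le_of_ricci_bound m hm one_pos (K := K * (Θ + 1)) (by positivity)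
  set c : ℝ := (Real.sqrt (MetricFlow.concentrationConst m) + C) * Real.sqrt Tm with hc
  have hc0 : 0 ≤ c := by positivity
  obtain ⟨A₀, hA₀, FWD⟩ :=
    exists_edist_lt_of_mem_pParabolicNhd_of_ricci_bound m hm hK (A := c + A) (Tp := Θ)
      (by positivity) hT
  set A' : ℝ := L * A₀ + L * Real.sqrt Θ + 1 with hA'
  have hA'0 : 0 < A' := by positivity
  have hαL : L * 1 * Real.sqrt Θ < A' := by
    rw [mul_one, hA']
    have := mul_pos hL0 hA₀
    linarith only [this]
  have hLA : L * A₀ ≤ A' := by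
    rw [hA']
    have : 0 ≤ L * Real.sqrt Θ := by positivity
    linarith only [this]
  refine ⟨A', hA'0, ?_⟩
  intro M _ _ _ _ _ _ _ _ _ h cov a T hflow hh hR t₀ r ht₀ hb hab hr hTT x₀ hRic t ht x hmem
  -- notation
  set b : ℝ := t₀ - Tm * r ^ 2 with hbdef
  let X : MetricFlow (Icc a T) := ricciFlowMetricFlow hh hR Set.ordConnected_Icc hflow
  have hr2 : 0 < r ^ 2 := pow_pos hr 2
  have hTmr : 0 ≤ Tm * r ^ 2 := mul_nonneg hTm hr2.le
  have hbt₀ : b ≤ t₀ := by rw [hbdef]; linarith only [hTmr]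
  have hΘr : b + Θ * r ^ 2 = t₀ + Tp * r ^ 2 := by rw [hbdef, hΘ]; ring
  have hK₁ : 0 ≤ K / r ^ 2 := div_nonneg hK hr2.le
  have hAr : 0 < A' * r := mul_pos hA'0 hr
  -- the membership, unfolded at the base time `b`
  obtain ⟨⟨hbt, htp⟩, hW⟩ := MetricFlow.mem_pParabolicNhd_iff.1 hmem
  have hbt : b ≤ t := hbt
  have htp : t ≤ t₀ + Tp * r ^ 2 := htp
  have hW : wassersteinW1 (X.condKernel (t := ⟨t₀, ht₀⟩) x₀ ⟨b, hb⟩)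
      (X.condKernel (t := ⟨t, ht⟩) x ⟨b, hb⟩) < ENNReal.ofReal (A * r) := hW
  /- the time interval `J = [b, t₀ + T⁺ r²]` carrying the curvature bound, and the backward
  distance distortion `d_{t₀}(x₀, y) ≤ L d_b(x₀, y)` for `L d_b(x₀, y) < A′ r` -/
  have hJ : Icc b (t₀ + Tp * r ^ 2) ⊆ Icc a T := Icc_subset_Icc hb.1 hTT
  have ht₀J : t₀ ∈ Icc b (t₀ + Tp * r ^ 2) := ⟨hbt₀, by nlinarith only [hTp, hr2]⟩
  have hbJ : b ∈ Icc b (t₀ + Tp * r ^ 2) := ⟨le_rfl, hbt₀.trans ht₀J.2⟩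
  have hJΘ : t₀ + Tp * r ^ 2 - b ≤ Θ * r ^ 2 := by linarith only [hΘr]
  have hexp : Real.exp (K / r ^ 2 * (t₀ + Tp * r ^ 2 - b)) = L := by
    rw [hL, ← hΘr]
    congr 1
    field_simp
    ring
  have hkL : Real.exp (K / r ^ 2 * (t₀ + Tp * r ^ 2 - b)) ≤ L := hexp.le
  have hconv : ∀ y : M, (h b).edist (hR b) x₀ y < ENNReal.ofReal (A₀ * r) →
      (h t₀).edist (hR t₀) x₀ y < ENNReal.ofReal (A' * r) := by
    intro y hy
    have hLne : ENNReal.ofReal L ≠ 0 := (ENNReal.ofReal_pos.2 hL0).ne'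
    have hy' : ENNReal.ofReal L * (h b).edist (hR b) x₀ y < ENNReal.ofReal (A' * r) :=
      calc ENNReal.ofReal L * (h b).edist (hR b) x₀ y
          < ENNReal.ofReal L * ENNReal.ofReal (A₀ * r) := by
            rw [mul_comm (ENNReal.ofReal L), mul_comm (ENNReal.ofReal L)]
            exact ENNReal.mul_lt_mul_left hLne ENNReal.ofReal_ne_top hy
        _ = ENNReal.ofReal (L * A₀ * r) := by rw [← ENNReal.ofReal_mul hL0.le, mul_assoc]
        _ ≤ ENNReal.ofReal (A' * r) :=
            ENNReal.ofReal_le_ofReal (mul_le_mul_of_nonneg_right hLA hr.le)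
    rw [← hexp] at hy'
    exact (edist_le_exp_mul_edist_of_ricci_bound_ball_rev hflow hR hJ hK₁ ht₀J x₀ hRic hbJ
      hy').trans_lt hy'
  /- Prop. 9.5 at `(x₀, t₀)` over `[b, t₀]`: `d^{b}_{W₁}(ν_{x₀,t₀;b}, δ_{x₀}) ≤ c r` -/
  have hx₀ball : (h t₀).edist (hR t₀) x₀ x₀ < ENNReal.ofReal (A' * r) := by
    rw [PseudoRiemannianMetric.edist_self]; exact ENNReal.ofReal_pos.2 hAr
  have ht₀b : t₀ - b ≤ Tm * r ^ 2 := by rw [hbdef]; linarith only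
  have hT1 : wassersteinW1 (X.condKernel (t := ⟨t₀, ht₀⟩) x₀ ⟨b, hb⟩)
      (Measure.dirac x₀ : Measure (X.Slice ⟨b, hb⟩)) ≤ ENNReal.ofReal (c * r) :=
    wassersteinW1_condKernel_dirac_le_of_ricci_bound hm hflow hh hR hC.le hb ht₀ hbt₀ hTm hr.le
      ht₀b x₀ fun hlt z hz ↦ h95 hflow hh hR hab hlt ht₀.2 x₀
        (ricci_bound_parabolic_of_ricci_bound_ball hflow hR hJ ht₀J hK hr hΘ0 hJΘ hkL one_pos hαL
          x₀ hRic ht₀J hlt) z hz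
  /- hence `(x, t)` lies in the forward neighbourhood `P*((x₀, b); (c + A) r, 0, Θ r²)` -/
  have hb0 : b - 0 ∈ Icc a T := by rw [sub_zero]; exact hb
  haveI := X.isProbabilityMeasure_condKernel (s := ⟨b, hb⟩) (t := ⟨t, ht⟩) x hbt
  have hlevel : wassersteinW1 (Measure.dirac x₀ : Measure (X.Slice ⟨b, hb⟩))
      (X.condKernel (t := ⟨t, ht⟩) x ⟨b, hb⟩) < ENNReal.ofReal ((c + A) * r) :=
    calc wassersteinW1 (Measure.dirac x₀ : Measure (X.Slice ⟨b, hb⟩))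
          (X.condKernel (t := ⟨t, ht⟩) x ⟨b, hb⟩)
        ≤ wassersteinW1 (Measure.dirac x₀ : Measure (X.Slice ⟨b, hb⟩))
              (X.condKernel (t := ⟨t₀, ht₀⟩) x₀ ⟨b, hb⟩) +
            wassersteinW1 (X.condKernel (t := ⟨t₀, ht₀⟩) x₀ ⟨b, hb⟩)
              (X.condKernel (t := ⟨t, ht⟩) x ⟨b, hb⟩) := wassersteinW1_triangle _ _ _
      _ < ENNReal.ofReal (c * r) + ENNReal.ofReal (A * r) := by
          refine ENNReal.add_lt_add_of_le_of_lt ?_ ?_ hW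
          · rw [wassersteinW1_comm]; exact ne_top_of_le_ne_top ENNReal.ofReal_ne_top hT1
          · rw [wassersteinW1_comm]; exact hT1
      _ = ENNReal.ofReal ((c + A) * r) := by
          rw [← ENNReal.ofReal_add (by positivity) (by positivity)]; ring_nf
  have hmem' : (⟨⟨t, ht⟩, x⟩ : X.Pt) ∈
      X.pParabolicNhd ⟨⟨b, hb⟩, x₀⟩ ((c + A) * r) 0 (Θ * r ^ 2) hb0 := by
    refine (MetricFlow.mem_pParabolicNhd_iff_of_coe_eq hb0 (s₀ := ⟨b, hb⟩)
      (show b = b - 0 from (sub_zero b).symm)).2 ⟨⟨hbt, ?_⟩, ?_⟩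
    · show t ≤ b + Θ * r ^ 2
      rw [hΘr]; exact htp
    · show wassersteinW1 (X.condKernel (t := ⟨b, hb⟩) x₀ ⟨b, hb⟩)
        (X.condKernel (t := ⟨t, ht⟩) x ⟨b, hb⟩) < ENNReal.ofReal ((c + A) * r)
      rw [X.condKernel_self]
      exact hlevel
  /- the forward case at the base point `(x₀, b)`, with its hypothesis ball converted -/
  have hRic_b : ∀ s ∈ Icc b (b + Θ * r ^ 2), ∀ y : M,
      (h b).edist (hR b) x₀ y < ENNReal.ofReal (A₀ * r) →
      ∀ v : TangentSpace 𝓘(ℝ, EuclideanSpace ℝ (Fin m)) y,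
        |(cov s).ricci y v v| ≤ K / r ^ 2 * (h s).val y v v := fun s hs y hy v ↦
    hRic s ⟨hs.1, by rw [← hΘr]; exact hs.2⟩ y (hconv y hy) v
  have hfwd : (h b).edist (hR b) x₀ x < ENNReal.ofReal (A₀ * r) :=
    FWD hflow hh hR hb hb0 hab hr (by rw [hΘr]; exact hTT) x₀ hRic_b ht x hmem'
  exact hconv x hfwd

end Literature.Geometry.Riemannian

end
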